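/-
Copyright (c) 2026 the pub-hodgecm-mathlib formalisation cell (harness21).  Prover seat hodgecm-mathlib-LH4-p04 (g2), req620 Track A «(D-RAM) FOUR-FRAME» squad
(unit U3_Laws, (KSS) road «MODULO κ-STAGE B», brick «κS-DICT» — THE THREE SIGN IDENTITIES AT THE SQUARE DATUM; dealer LH4-plan (g11) WORD #49 (2);
letters `F0/P3c/LH4/LH4-p04/g2/LETTER-kappaS-DICT.v1` 081581c71998dd48; consumers LH4-p14 (g3) κS-assembler, LH4-p09 (g3) κB-G, LH4-p06 (g3) κB-H).  2026-09-04.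
-/
import Summits.HodgeConjecture.HodgeConjecture.Theorems.F0P3cDyRamDiagonalKappaCountEval        -- ★ Fκ2 (LH4-p05): `chiVec`; brings ★ `normSign_mul_norm` (p855032), ★ `normSign`, `fPart`, `fPartProd` (★ #0a)
import Literature.NumberTheory.LocalFields.WildQuadraticDatumNormSignConductor                     -- ★ (LH4-p06 (g3)): `normSign_mul_eq_of_fixed_of_v_sub_one_le` (deep fixed one-units do not change ω), `normSign_mul_of_fixed` (ω multiplicative); brings ★ `normSign_one`
import Literature.NumberTheory.Automorphic.UnitaryThreeFourFrameFixedCosetDictionary               -- ★ `v_eq_one_of_mul_map_eq_one` (norm-one ⇒ unit)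
import Summits.HodgeConjecture.HodgeConjecture.Theorems.F0P3cDyRamDiagonalKappaSplitCountEval     -- ★ p856621 (this seat): `chiVec_zero∕one∕two`, `normSign_mul_self`
import Summits.HodgeConjecture.HodgeConjecture.Theorems.F0P3cDyRamCayleySignFPartProd            -- ★ (LH4-p06 (g0)): `fPartProd_two` (reused, not restated)
import HarnessLib

/-!
# Crux `H413`, line LH4 «(D-RAM) FOUR-FRAME» road — unit U3_Laws (iii), (KSS) road «MODULO κ-STAGE B», brick «κS-DICT»: THE THREE SIGN IDENTITIES AT THE SQUARE DATUM —
# the glue-witness signs `ω(f₀)`, `ω(1 + f₀)`, `ω(f₀(1+f₀))` of the κ-Stage-B table ARE the law's slot signs `ω(−1)^{[i≠0]}·ω(fPartProd δ (a,b,1) i)`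

Cell `hodgecm-mathlib` (D-0151), FLOOR 0, crux item H413 = `stmt-HodgeConjecture-24833`, route of record `HCCMUnconditional`; squad F0∕P3c∕LH4 (req618∕req620); registered stub served:
`F0P3cDyRamFourFrameU3.stub_U3_kappaSignModelSum` (KSS; tree `Cruxes/H413/Lines/F0_P3c_DyRamFourFrame_U3_Laws.lean` ED. 9 :507ff), via LH4-p05 (g3)'s reduction head
`…KappaSignModelSumOfKappaStageB` (ED. 2) and LH4-p14 (g3)'s κS-assembler (binder `hdict`).  THEOREMS ONLY (no `def`, no instance, no notation, no `sorry`, default heartbeats);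
lane `--supports stmt-HodgeConjecture-24833 --as helper` (count-neutral).

THE MATHEMATICS (letter κS-DICT v1).  SQUARE DATUM: `a σa = 1`, `b σb = 1`, `σδ = −δ ≠ 0`, `α = a², β = b²` pairwise distinct from each other and from `1`; `l = (a, b, 1)`,
`x_ij := fPart δ l i j = (l_i² − l_j²)∕(l_i l_j δ)` — σ-FIXED (σ l_i = l_i⁻¹) and non-zero; `fPartProd δ l 0 = x₀₁x₀₂`, `fPartProd δ l 1 = x₁₀x₁₂`, `fPartProd δ l 2 = x₂₀x₂₁`.
The κ-Stage-B table (LH4-p09 (g3) LETTER κB-G §3∕§5, LH4-p06 (g3) LETTER κB-H §3) carries, on the glue shells, the signs `ω(f₀)`, `ω(1+f₀)`, `ω(f₀(1+f₀))` of a σ-FIXED glue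
witness `f₀` close to `−g`, `g := (β − 1)∕(α − 1)` (itself NOT fixed: `σg = g·α∕β`), while the law (KSS) carries `w_i·baseSign_i·ω(fPartProd δ l i) = ω(−1)·ω(fPartProd δ l i)`.
KEY ALGEBRA: `−g = (b∕a)·(x₂₁∕x₀₂)`, `1 − g = b·(x₀₁∕x₀₂)`, `fPartProd₀ · fPartProd₂ = −x₀₂² · fPartProd₁` — so the F-germs of `f₀` and `1 + f₀` are `x₂₁x₀₂ = −fPartProd₂` and
`x₀₁x₀₂ = fPartProd₀` UP TO the norm-one units `b∕a`, `b`.  ENGINE (`normSign_eq_of_germ`): if `f` is fixed, `|c − 1| ≤ |ϖ|^n` and `|f − c·(x∕y)| ≤ |ϖ|^n·|x∕y|` with `x, y`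
fixed and `2d − 1 ≤ n`, then `u := f·y∕x` is a fixed one-unit of `F`-level `≥ d`, hence does not change `ω` (★ deep norms, Serre V §3 Cor. 3 via LH4-p06's toolkit), and
`ω(f) = ω(x∕y) = ω(xy)`.  Hence, with the unit depths `|a − b| ≤ |ϖ|^n` resp. `|b − 1| ≤ |ϖ|^n` and the RELATIVE glue depth `|f₀ + g| ≤ |ϖ|^n·|g|` resp. `≤ |ϖ|^n·|1 − g|`:
(D2) `ω(f₀) = ω(−1)·ω(fPartProd δ l 2)`;  (D0) `ω(1 + f₀) = ω(fPartProd δ l 0)`;  (D1) `ω(f₀(1+f₀)) = ω(fPartProd δ l 1)` (from (D0)(D2) by multiplicativity and the key algebra);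
and in LH4-p06's `chiVec` currency `χ_i(f₀, 1, −(1+f₀)⁻¹) = ω(−1)·ω(fPartProd δ l i)` for every `i`.  WHERE THE DEPTHS COME FROM (assembler's side): `|a − b| = |ϖ|^{n₃ − t}`,
`|b − 1| = |ϖ|^{n₁ − t}` (`|a − 1|, |b − 1| < |2|`), relative glue depth `= 2ρ − m` (+`s` on the apex); all `≥ 2d − 1` in the alive glue windows when `d ≥ t` (every parameter of
record; letter §3 flags the data `d` even `≤ t − 2`).

WHAT IS PROVED.  §1 `fPart` algebra at the square datum (fixedness, non-vanishing, unfoldings, the key identities).  §2 the engine `normSign_eq_of_germ`.  §3 the heads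
`normSign_glueWitness_eq` (D2), `normSign_one_add_glueWitness_eq` (D0), `normSign_glueWitness_mul_one_add_eq` (D1), `chiVec_glueWitness_eq` (all `i`, LH4-p06's H-currency).
HONEST LABEL.  Count-neutral (`--supports`); nothing printed is asserted; (KSS) stays a PROVER TARGET (empirical census law in diagonal-model currency); `HC_CM` is proved only modulo
the 7 printed citations (2 remaining named inputs: hLiu418 = `stmt-HodgeConjecture-24832`, h413 = `stmt-HodgeConjecture-24833`) until rung 0 closes.

## References
* [Rogawski1990] J. D. Rogawski, *Automorphic Representations of Unitary Groups in Three Variables*, Ann. of Math. Stud. 123 (1990), §4.9 p. 55 (the `F`-parts `x_ij` of the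
  near-identity roots), §4.10 p. 58 (the κ-signs).
* [Serre1979] J.-P. Serre, *Local Fields*, GTM 67 (1979), Ch. V §3 Prop. 5, Cor. 3 (deep one-units are norms: the conductor of a ramified quadratic extension), Ch. XV §2.
* [LanglandsShelstad1987] R. P. Langlands, D. Shelstad, *On the definition of transfer factors*, Math. Ann. 278 (1987), §3 (κ as a character).
-/

set_option autoImplicit false

noncomputable section

namespace Summit.HodgeConjecture.HodgeConjecture.Cruxes.H413.F0P3cDyRamDiagonalKappaSignDictionary

open Matrix
open Literature.NumberTheory.Automorphic Literature.NumberTheory.Automorphic.UnitaryThreeFourFrame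
open Literature.NumberTheory.LocalFields Literature.NumberTheory.LocalFields.WildQuadraticDatum
open Summit.HodgeConjecture.HodgeConjecture.Cruxes.H413.F0P3cDyRamDiagonalKappaCountDefs
open Summit.HodgeConjecture.HodgeConjecture.Cruxes.H413.F0P3cDyRamFixedCountDiagonalModel (normSign_mul_norm)
open Summit.HodgeConjecture.HodgeConjecture.Cruxes.H413.F0P3cDyRamStableSumSignClasses (normSign_eq_one_or)
open Summit.HodgeConjecture.HodgeConjecture.Cruxes.H413.F0P3cDyRamDiagonalKappaSplitCountEval (chiVec_zero chiVec_one chiVec_two normSign_mul_self)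
open Summit.HodgeConjecture.HodgeConjecture.Cruxes.H413.F0P3cDyRamCayleySignFPartProd (fPartProd_two)
open scoped Valued WithZero Matrix MatrixGroups

variable {K : Type} [Field K]

/-! ## §1  `fPart` algebra at the square datum `l = (a, b, 1)` -/

/-- A norm-one element is inverted by `σ`: `aσa = 1 ⇒ σ a = a⁻¹`. [cite: Rogawski1990, §4.9 p. 55] -/
theorem map_eq_inv_of_mul_map_eq_one {σ : K →+* K} {a : K} (ha : a * σ a = 1) : σ a = a⁻¹ :=
  (eq_inv_of_mul_eq_one_right ha)

/-- A norm-one element is non-zero. [cite: Rogawski1990, §4.9 p. 55] -/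
theorem ne_zero_of_mul_map_eq_one {σ : K →+* K} {a : K} (ha : a * σ a = 1) : a ≠ 0 :=
  fun h => by rw [h, zero_mul] at ha; exact zero_ne_one ha

/-- **THE `F`-PART OF TWO NORM-ONE ROOTS IS `σ`-FIXED**: `σ((p² − q²)∕(pqδ)) = (p² − q²)∕(pqδ)` for `pσp = qσq = 1` and skew `δ` (★ #0a H9 «`x_ij ∈ F`»).
[cite: Rogawski1990, §4.9 p. 55] -/
theorem map_fPart_val_eq {σ : K →+* K} {δ p q : K} (hδ : σ δ = -δ) (hp : p * σ p = 1) (hq : q * σ q = 1) :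
    σ ((p * p - q * q) / (p * q * δ)) = (p * p - q * q) / (p * q * δ) := by
  have hp0 := ne_zero_of_mul_map_eq_one hp
  have hq0 := ne_zero_of_mul_map_eq_one hq
  by_cases hδ0 : δ = 0
  · simp [hδ0]
  rw [map_div₀, map_sub, map_mul, map_mul, map_mul, map_mul, map_eq_inv_of_mul_map_eq_one hp, map_eq_inv_of_mul_map_eq_one hq, hδ]
  field_simp
  ring

/-- `fPart` at `l = (a, b, 1)` is `σ`-fixed in every slot pair (norm-one `a, b`, skew `δ`). [cite: Rogawski1990, §4.9 p. 55] -/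
theorem map_fPart_eq {σ : K →+* K} {δ a b : K} (hδ : σ δ = -δ) (ha : a * σ a = 1) (hb : b * σ b = 1) (i j : Fin 3) :
    σ (fPart δ ![a, b, 1] i j) = fPart δ ![a, b, 1] i j := by
  have hl : ∀ k : Fin 3, (![a, b, 1] : Fin 3 → K) k * σ ((![a, b, 1] : Fin 3 → K) k) = 1 := by
    intro k
    fin_cases k
    · exact ha
    · exact hb
    · simp
  unfold fPart
  exact map_fPart_val_eq hδ (hl i) (hl j)

/-- `fPart δ l i j ≠ 0` when `l_i² ≠ l_j²` and `l_i, l_j, δ ≠ 0`. [cite: Rogawski1990, §4.9 p. 55] -/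
theorem fPart_ne_zero {δ : K} {l : Fin 3 → K} {i j : Fin 3} (hδ0 : δ ≠ 0) (hi : l i ≠ 0) (hj : l j ≠ 0) (hij : l i * l i ≠ l j * l j) :
    fPart δ l i j ≠ 0 := by
  unfold fPart
  exact div_ne_zero (sub_ne_zero.2 hij) (mul_ne_zero (mul_ne_zero hi hj) hδ0)

/-- `fPartProd δ l 0 = fPart δ l 0 1 · fPart δ l 0 2` (★ #0a H10 unfolded). [cite: Rogawski1990, §4.9 p. 55] -/
theorem fPartProd_zero (δ : K) (l : Fin 3 → K) : fPartProd δ l 0 = fPart δ l 0 1 * fPart δ l 0 2 := by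
  simp [fPartProd]

/-- `fPartProd δ l 1 = fPart δ l 1 0 · fPart δ l 1 2`. [cite: Rogawski1990, §4.9 p. 55] -/
theorem fPartProd_one (δ : K) (l : Fin 3 → K) : fPartProd δ l 1 = fPart δ l 1 0 * fPart δ l 1 2 := by
  simp [fPartProd]

/-- The six `F`-parts at `l = (a, b, 1)`, unfolded. [cite: Rogawski1990, §4.9 p. 55] -/
theorem fPart_square_datum (δ a b : K) :
    fPart δ ![a, b, 1] 0 1 = (a * a - b * b) / (a * b * δ) ∧ fPart δ ![a, b, 1] 0 2 = (a * a - 1) / (a * δ) ∧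
    fPart δ ![a, b, 1] 1 0 = (b * b - a * a) / (b * a * δ) ∧ fPart δ ![a, b, 1] 1 2 = (b * b - 1) / (b * δ) ∧
    fPart δ ![a, b, 1] 2 0 = (1 - a * a) / (a * δ) ∧ fPart δ ![a, b, 1] 2 1 = (1 - b * b) / (b * δ) := by
  unfold fPart
  refine ⟨by simp, by simp, by simp, by simp, by simp, by simp⟩

/-- **KEY ALGEBRA (i): `−g = (b∕a)·(x₂₁∕x₀₂)`** for `g = (β−1)∕(α−1)`, `α = a²`, `β = b²`. [cite: Rogawski1990, §4.9 p. 55] -/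
theorem neg_glueUnit_eq {δ a b : K} (hδ0 : δ ≠ 0) (ha0 : a ≠ 0) (hb0 : b ≠ 0) (hα1 : a * a ≠ 1) :
    -((b * b - 1) / (a * a - 1)) = (b / a) * (fPart δ ![a, b, 1] 2 1 / fPart δ ![a, b, 1] 0 2) := by
  obtain ⟨-, h02, -, -, -, h21⟩ := fPart_square_datum δ a b
  rw [h02, h21]
  have : a * a - 1 ≠ 0 := sub_ne_zero.2 hα1
  field_simp
  ring

/-- **KEY ALGEBRA (ii): `1 − g = (α − β)∕(α − 1) = b·(x₀₁∕x₀₂)`**. [cite: Rogawski1990, §4.9 p. 55] -/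
theorem one_sub_glueUnit_eq {δ a b : K} (hδ0 : δ ≠ 0) (ha0 : a ≠ 0) (hb0 : b ≠ 0) (hα1 : a * a ≠ 1) :
    1 - (b * b - 1) / (a * a - 1) = b * (fPart δ ![a, b, 1] 0 1 / fPart δ ![a, b, 1] 0 2) := by
  obtain ⟨h01, h02, -, -, -, -⟩ := fPart_square_datum δ a b
  have h1 : a * a - 1 ≠ 0 := sub_ne_zero.2 hα1
  rw [h01, h02, one_sub_div h1, div_div_div_eq, mul_div_assoc', div_eq_div_iff h1 (mul_ne_zero (mul_ne_zero (mul_ne_zero ha0 hb0) hδ0) h1)]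
  ring

/-- **KEY ALGEBRA (iii): `fPartProd₀ · fPartProd₂ = −x₀₂² · fPartProd₁`**. [cite: Rogawski1990, §4.9 p. 55] -/
theorem fPartProd_zero_mul_two {δ a b : K} (hδ0 : δ ≠ 0) (ha0 : a ≠ 0) (hb0 : b ≠ 0) :
    fPartProd δ ![a, b, 1] 0 * fPartProd δ ![a, b, 1] 2 = -(fPart δ ![a, b, 1] 0 2 * fPart δ ![a, b, 1] 0 2) * fPartProd δ ![a, b, 1] 1 := by
  obtain ⟨h01, h02, h10, h12, h20, h21⟩ := fPart_square_datum δ a b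
  rw [fPartProd_zero, fPartProd_one, fPartProd_two, h01, h02, h10, h12, h20, h21]
  field_simp
  ring

/-- `x₂₁·x₀₂ = −fPartProd₂` (`x₀₂ = −x₂₀`). [cite: Rogawski1990, §4.9 p. 55] -/
theorem fPart_two_one_mul_zero_two {δ a b : K} (hδ0 : δ ≠ 0) (ha0 : a ≠ 0) (hb0 : b ≠ 0) :
    fPart δ ![a, b, 1] 2 1 * fPart δ ![a, b, 1] 0 2 = -fPartProd δ ![a, b, 1] 2 := by
  obtain ⟨-, h02, -, -, h20, h21⟩ := fPart_square_datum δ a b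
  rw [fPartProd_two, h02, h20, h21]
  field_simp
  ring

/-- **THE `(0 1)` SYMMETRY OF THE SLOT PRODUCTS**: swapping the two roots `a ↔ b` swaps `fPartProd₀ ↔ fPartProd₁` and fixes `fPartProd₂` — so the foot-`1` dictionary is the
foot-`0` dictionary at the datum `(b, a)`. [cite: Rogawski1990, §4.9 p. 55] -/
theorem fPartProd_swap (δ a b : K) :
    fPartProd δ ![b, a, 1] 0 = fPartProd δ ![a, b, 1] 1 ∧ fPartProd δ ![b, a, 1] 1 = fPartProd δ ![a, b, 1] 0 ∧
      fPartProd δ ![b, a, 1] 2 = fPartProd δ ![a, b, 1] 2 := by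
  obtain ⟨h01, h02, h10, h12, h20, h21⟩ := fPart_square_datum δ a b
  obtain ⟨k01, k02, k10, k12, k20, k21⟩ := fPart_square_datum δ b a
  refine ⟨?_, ?_, ?_⟩
  · rw [fPartProd_zero, fPartProd_one, k01, k02, h10, h12]
  · rw [fPartProd_zero, fPartProd_one, k10, k12, h01, h02]
  · rw [fPartProd_two, fPartProd_two, k20, k21, h20, h21, mul_comm]

section Valued

variable [Valued K ℤᵐ⁰]

/-! ## §2  The engine: a fixed element close to `c·(x∕y)` with `c` a deep unit and `x, y` fixed has `ω = ω(xy)` -/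

/-- **GERM ENGINE.**  Let `x, y, f` be `σ`-fixed, `x, y ≠ 0`, `2d − 1 ≤ n`, `|c − 1| ≤ |ϖ|^n` and `|f − c·(x∕y)| ≤ |ϖ|^n·|x∕y|`.  Then `ω(f) = ω(x·y)`: `u := f·(y∕x)` is fixed with
`|u − 1| ≤ |ϖ|^n`, so `ω((x∕y)·u) = ω(x∕y)` (★ `normSign_mul_eq_of_fixed_of_v_sub_one_le`: fixed one-units of `F`-level `≥ d` are norms), and `x∕y = xy·N(y⁻¹)`.
[cite: Serre1979, Ch. V §3 Prop. 5, Cor. 3] [cite: Rogawski1990, §4.9 p. 55] -/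
theorem normSign_eq_of_germ [CompleteSpace K] {σ : K →+* K} {ϖ : K} {d t : ℕ} (hD : IsRamifiedQuadraticDatum σ ϖ d t) {x y f c : K}
    (hσx : σ x = x) (hσy : σ y = y) (hx0 : x ≠ 0) (hy0 : y ≠ 0) (hσf : σ f = f) {n : ℕ} (hn : 2 * d - 1 ≤ n)
    (hc : Valued.v (c - 1) ≤ Valued.v ϖ ^ n) (hf : Valued.v (f - c * (x / y)) ≤ Valued.v ϖ ^ n * Valued.v (x / y)) :
    normSign σ f = normSign σ (x * y) := by
  set u : K := f * (y / x) with hu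
  have hσu : σ u = u := by rw [hu, map_mul, map_div₀, hσf, hσx, hσy]
  have hfu : f = (x / y) * u := by rw [hu]; field_simp
  have hfx : Valued.v (f - x / y) ≤ Valued.v ϖ ^ n * Valued.v (x / y) := by
    have esplit : f - x / y = (f - c * (x / y)) + (c - 1) * (x / y) := by ring
    rw [esplit]
    refine (Valuation.map_add _ _ _).trans (max_le hf ?_)
    rw [map_mul]
    exact mul_le_mul' hc le_rfl
  have hu1 : Valued.v (u - 1) ≤ Valued.v ϖ ^ n := by
    have e : u - 1 = (f - x / y) * (y / x) := by rw [hu]; field_simp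
    calc Valued.v (u - 1) = Valued.v (f - x / y) * Valued.v (y / x) := by rw [e, map_mul]
      _ ≤ Valued.v ϖ ^ n * Valued.v (x / y) * Valued.v (y / x) := mul_le_mul' hfx le_rfl
      _ = Valued.v ϖ ^ n := by
        rw [mul_assoc, ← map_mul, show x / y * (y / x) = 1 from by field_simp, map_one, mul_one]
  rw [hfu, normSign_mul_eq_of_fixed_of_v_sub_one_le hD (x / y) hσu hn hu1]
  have e2 : x / y = (x * y) * (y⁻¹ * σ y⁻¹) := by rw [map_inv₀, hσy]; field_simp
  rw [e2, normSign_mul_norm σ (x * y) (inv_ne_zero hy0)]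

/-! ## §3  The three sign identities at the square datum -/

/-- **`ω(fPartProd₂)·ω(fPartProd₀) = ω(−1)·ω(fPartProd₁)`** at the square datum (key algebra (iii) + multiplicativity of `ω` on fixed elements).
[cite: Rogawski1990, §4.9 p. 55] [cite: Serre1979, Ch. V §3 Cor. 3] -/
theorem normSign_fPartProd_two_mul_zero [CompleteSpace K] [Fintype 𝓀[K]] {σ : K →+* K} {ϖ : K} {d t : ℕ} (hD : IsRamifiedQuadraticDatum σ ϖ d t)
    {δ a b : K} (hδ : σ δ = -δ) (hδ0 : δ ≠ 0) (ha : a * σ a = 1) (hb : b * σ b = 1) (hα1 : a * a ≠ 1) (hβ1 : b * b ≠ 1) (hαβ : a * a ≠ b * b) :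
    normSign σ (fPartProd δ ![a, b, 1] 2) * normSign σ (fPartProd δ ![a, b, 1] 0) = normSign σ (-1) * normSign σ (fPartProd δ ![a, b, 1] 1) := by
  have ha0 := ne_zero_of_mul_map_eq_one ha
  have hb0 := ne_zero_of_mul_map_eq_one hb
  have hy : σ (fPart δ ![a, b, 1] 0 2) = fPart δ ![a, b, 1] 0 2 := map_fPart_eq hδ ha hb 0 2
  have hσP : ∀ i : Fin 3, σ (fPartProd δ ![a, b, 1] i) = fPartProd δ ![a, b, 1] i := by
    intro i
    fin_cases i
    · show σ (fPartProd δ ![a, b, 1] 0) = fPartProd δ ![a, b, 1] 0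
      rw [fPartProd_zero, map_mul, map_fPart_eq hδ ha hb, map_fPart_eq hδ ha hb]
    · show σ (fPartProd δ ![a, b, 1] 1) = fPartProd δ ![a, b, 1] 1
      rw [fPartProd_one, map_mul, map_fPart_eq hδ ha hb, map_fPart_eq hδ ha hb]
    · show σ (fPartProd δ ![a, b, 1] 2) = fPartProd δ ![a, b, 1] 2
      rw [fPartProd_two, map_mul, map_fPart_eq hδ ha hb, map_fPart_eq hδ ha hb]
  have h1ne : (1 : K) * 1 ≠ b * b := fun h => hβ1 (by rw [← h, mul_one])
  have h01 : fPart δ ![a, b, 1] 0 1 ≠ 0 := fPart_ne_zero (l := ![a, b, 1]) hδ0 (by simp [ha0]) (by simp [hb0]) (by simpa using hαβ)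
  have h02 : fPart δ ![a, b, 1] 0 2 ≠ 0 := fPart_ne_zero (l := ![a, b, 1]) hδ0 (by simp [ha0]) (by simp) (by simpa using hα1)
  have h20 : fPart δ ![a, b, 1] 2 0 ≠ 0 := fPart_ne_zero (l := ![a, b, 1]) hδ0 (by simp) (by simp [ha0]) (by simpa using fun h => hα1 h.symm)
  have h21 : fPart δ ![a, b, 1] 2 1 ≠ 0 := fPart_ne_zero (l := ![a, b, 1]) hδ0 (by simp) (by simp [hb0]) (by simpa using h1ne)
  have hP0 : fPartProd δ ![a, b, 1] 0 ≠ 0 := by rw [fPartProd_zero]; exact mul_ne_zero h01 h02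
  have hP2 : fPartProd δ ![a, b, 1] 2 ≠ 0 := by rw [fPartProd_two]; exact mul_ne_zero h20 h21
  have hkey := fPartProd_zero_mul_two hδ0 ha0 hb0
  have hP1 : fPartProd δ ![a, b, 1] 1 ≠ 0 := by
    intro h
    rw [h, mul_zero] at hkey
    exact mul_ne_zero hP0 hP2 hkey
  have hN0 : fPart δ ![a, b, 1] 0 2 * σ (fPart δ ![a, b, 1] 0 2) ≠ 0 := mul_ne_zero h02 (by rw [hy]; exact h02)
  have hσQ : σ (fPartProd δ ![a, b, 1] 1 * (fPart δ ![a, b, 1] 0 2 * σ (fPart δ ![a, b, 1] 0 2))) =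
      fPartProd δ ![a, b, 1] 1 * (fPart δ ![a, b, 1] 0 2 * σ (fPart δ ![a, b, 1] 0 2)) := by
    rw [map_mul, map_mul, hσP 1, hy, hy]
  rw [← normSign_mul_of_fixed hD (hσP 2) (hσP 0) hP2 hP0, mul_comm (fPartProd δ ![a, b, 1] 2), hkey,
    show -(fPart δ ![a, b, 1] 0 2 * fPart δ ![a, b, 1] 0 2) * fPartProd δ ![a, b, 1] 1 =
      (-1) * (fPartProd δ ![a, b, 1] 1 * (fPart δ ![a, b, 1] 0 2 * σ (fPart δ ![a, b, 1] 0 2))) from by rw [hy]; ring,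
    normSign_mul_of_fixed hD (by rw [map_neg, map_one]) hσQ (neg_ne_zero.2 one_ne_zero) (mul_ne_zero hP1 hN0),
    normSign_mul_norm σ _ h02]

/-- **(D2) THE GLUE WITNESS: `ω(f₀) = ω(−1)·ω(fPartProd δ (a,b,1) 2)`** — for a σ-fixed `f₀` with `|f₀ + g| ≤ |ϖ|^n·|g|` (`g = (b²−1)∕(a²−1)`), `|a − b| ≤ |ϖ|^n`, `2d − 1 ≤ n`
(germ `−g = (b∕a)·x₂₁∕x₀₂`, `x₂₁x₀₂ = −fPartProd₂`; LH4-p09's `glueSign 2 = ω(f₀)`, LH4-p06's `χ₂(f₀) = ω(f₀)`).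
[cite: Rogawski1990, §4.9 p. 55, §4.10 p. 58] [cite: Serre1979, Ch. V §3 Prop. 5, Cor. 3] -/
theorem normSign_glueWitness_eq [CompleteSpace K] [Fintype 𝓀[K]] {σ : K →+* K} {ϖ : K} {d t : ℕ} (hD : IsRamifiedQuadraticDatum σ ϖ d t)
    {δ a b : K} (hδ : σ δ = -δ) (hδ0 : δ ≠ 0) (ha : a * σ a = 1) (hb : b * σ b = 1) (hα1 : a * a ≠ 1) (hβ1 : b * b ≠ 1)
    {f₀ : K} (hσf₀ : σ f₀ = f₀) {n : ℕ} (hn : 2 * d - 1 ≤ n) (hab : Valued.v (a - b) ≤ Valued.v ϖ ^ n)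
    (hf₀ : Valued.v (f₀ + (b * b - 1) / (a * a - 1)) ≤ Valued.v ϖ ^ n * Valued.v ((b * b - 1) / (a * a - 1))) :
    normSign σ f₀ = normSign σ (-1) * normSign σ (fPartProd δ ![a, b, 1] 2) := by
  have hvσ := hD.2.1
  have ha0 := ne_zero_of_mul_map_eq_one ha
  have hb0 := ne_zero_of_mul_map_eq_one hb
  have hva : Valued.v a = 1 := v_eq_one_of_mul_map_eq_one hvσ ha
  have hvb : Valued.v b = 1 := v_eq_one_of_mul_map_eq_one hvσ hb
  have h1ne : (1 : K) * 1 ≠ b * b := fun h => hβ1 (by rw [← h, mul_one])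
  -- `x := x₂₁`, `y := x₀₂`, `c := b ∕ a`
  have hx : σ (fPart δ ![a, b, 1] 2 1) = fPart δ ![a, b, 1] 2 1 := map_fPart_eq hδ ha hb 2 1
  have hy : σ (fPart δ ![a, b, 1] 0 2) = fPart δ ![a, b, 1] 0 2 := map_fPart_eq hδ ha hb 0 2
  have hx0 : fPart δ ![a, b, 1] 2 1 ≠ 0 := fPart_ne_zero (l := ![a, b, 1]) hδ0 (by simp) (by simp [hb0]) (by simpa using h1ne)
  have hy0 : fPart δ ![a, b, 1] 0 2 ≠ 0 := fPart_ne_zero (l := ![a, b, 1]) hδ0 (by simp [ha0]) (by simp) (by simpa using hα1)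
  have hgerm : (b / a) * (fPart δ ![a, b, 1] 2 1 / fPart δ ![a, b, 1] 0 2) = -((b * b - 1) / (a * a - 1)) :=
    (neg_glueUnit_eq hδ0 ha0 hb0 hα1).symm
  have hc : Valued.v (b / a - 1) ≤ Valued.v ϖ ^ n := by
    have e : b / a - 1 = (b - a) * a⁻¹ := by field_simp
    rw [e, map_mul, map_inv₀, hva, inv_one, mul_one, Valuation.map_sub_swap]
    exact hab
  have hvq : Valued.v (fPart δ ![a, b, 1] 2 1 / fPart δ ![a, b, 1] 0 2) = Valued.v ((b * b - 1) / (a * a - 1)) := by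
    have e : fPart δ ![a, b, 1] 2 1 / fPart δ ![a, b, 1] 0 2 = (a / b) * -((b * b - 1) / (a * a - 1)) := by
      rw [← hgerm]; field_simp
    rw [e, map_mul, Valuation.map_neg, map_div₀, hva, hvb, div_one, one_mul]
  have hf : Valued.v (f₀ - b / a * (fPart δ ![a, b, 1] 2 1 / fPart δ ![a, b, 1] 0 2)) ≤
      Valued.v ϖ ^ n * Valued.v (fPart δ ![a, b, 1] 2 1 / fPart δ ![a, b, 1] 0 2) := by
    rw [hgerm, sub_neg_eq_add, hvq]
    exact hf₀
  rw [normSign_eq_of_germ hD hx hy hx0 hy0 hσf₀ hn hc hf, fPart_two_one_mul_zero_two hδ0 ha0 hb0, neg_eq_neg_one_mul,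
    normSign_mul_of_fixed hD (by rw [map_neg, map_one]) ?_ (neg_ne_zero.2 one_ne_zero) ?_]
  · rw [fPartProd_two, map_mul, map_fPart_eq hδ ha hb, map_fPart_eq hδ ha hb]
  · rw [fPartProd_two]
    exact mul_ne_zero (fPart_ne_zero (l := ![a, b, 1]) hδ0 (by simp) (by simp [ha0]) (by simpa using fun h => hα1 h.symm))
      hx0

/-- **(D0) THE APEX: `ω(1 + f₀) = ω(fPartProd δ (a,b,1) 0)`** — for a σ-fixed `f₀` with `|f₀ + g| ≤ |ϖ|^n·|1 − g|`, `|b − 1| ≤ |ϖ|^n`, `2d − 1 ≤ n`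
(germ `1 − g = b·x₀₁∕x₀₂`, `x₀₁x₀₂ = fPartProd₀`; LH4-p09's `glueSign 0 = ω(−1)ω(1+f₀)`, LH4-p06's `χ₀(f₀) = ω(−(1+f₀))`).
[cite: Rogawski1990, §4.9 p. 55, §4.10 p. 58] [cite: Serre1979, Ch. V §3 Prop. 5, Cor. 3] -/
theorem normSign_one_add_glueWitness_eq [CompleteSpace K] {σ : K →+* K} {ϖ : K} {d t : ℕ} (hD : IsRamifiedQuadraticDatum σ ϖ d t)
    {δ a b : K} (hδ : σ δ = -δ) (hδ0 : δ ≠ 0) (ha : a * σ a = 1) (hb : b * σ b = 1) (hα1 : a * a ≠ 1) (hαβ : a * a ≠ b * b)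
    {f₀ : K} (hσf₀ : σ f₀ = f₀) {n : ℕ} (hn : 2 * d - 1 ≤ n) (hb1 : Valued.v (b - 1) ≤ Valued.v ϖ ^ n)
    (hf₀ : Valued.v (f₀ + (b * b - 1) / (a * a - 1)) ≤ Valued.v ϖ ^ n * Valued.v (1 - (b * b - 1) / (a * a - 1))) :
    normSign σ (1 + f₀) = normSign σ (fPartProd δ ![a, b, 1] 0) := by
  have hvσ := hD.2.1
  have ha0 := ne_zero_of_mul_map_eq_one ha
  have hb0 := ne_zero_of_mul_map_eq_one hb
  have hvb : Valued.v b = 1 := v_eq_one_of_mul_map_eq_one hvσ hb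
  have hx : σ (fPart δ ![a, b, 1] 0 1) = fPart δ ![a, b, 1] 0 1 := map_fPart_eq hδ ha hb 0 1
  have hy : σ (fPart δ ![a, b, 1] 0 2) = fPart δ ![a, b, 1] 0 2 := map_fPart_eq hδ ha hb 0 2
  have hx0 : fPart δ ![a, b, 1] 0 1 ≠ 0 := fPart_ne_zero (l := ![a, b, 1]) hδ0 (by simp [ha0]) (by simp [hb0]) (by simpa using hαβ)
  have hy0 : fPart δ ![a, b, 1] 0 2 ≠ 0 := fPart_ne_zero (l := ![a, b, 1]) hδ0 (by simp [ha0]) (by simp) (by simpa using hα1)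
  have hgerm : b * (fPart δ ![a, b, 1] 0 1 / fPart δ ![a, b, 1] 0 2) = 1 - (b * b - 1) / (a * a - 1) :=
    (one_sub_glueUnit_eq hδ0 ha0 hb0 hα1).symm
  have hvq : Valued.v (fPart δ ![a, b, 1] 0 1 / fPart δ ![a, b, 1] 0 2) = Valued.v (1 - (b * b - 1) / (a * a - 1)) := by
    have e : fPart δ ![a, b, 1] 0 1 / fPart δ ![a, b, 1] 0 2 = b⁻¹ * (1 - (b * b - 1) / (a * a - 1)) := by
      rw [← hgerm]; field_simp
    rw [e, map_mul, map_inv₀, hvb, inv_one, one_mul]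
  have hf : Valued.v (1 + f₀ - b * (fPart δ ![a, b, 1] 0 1 / fPart δ ![a, b, 1] 0 2)) ≤
      Valued.v ϖ ^ n * Valued.v (fPart δ ![a, b, 1] 0 1 / fPart δ ![a, b, 1] 0 2) := by
    rw [hgerm, hvq, show 1 + f₀ - (1 - (b * b - 1) / (a * a - 1)) = f₀ + (b * b - 1) / (a * a - 1) from by ring]
    exact hf₀
  have hσf : σ (1 + f₀) = 1 + f₀ := by rw [map_add, map_one, hσf₀]
  rw [normSign_eq_of_germ hD hx hy hx0 hy0 hσf hn hb1 hf, fPartProd_zero]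

/-- **(D1) THE CROSS SLOT: `ω(f₀·(1 + f₀)) = ω(fPartProd δ (a,b,1) 1)`** — under the hypotheses of (D0) and (D2): `ω(f₀)ω(1+f₀) = ω(−1)ω(fPartProd₂)·ω(fPartProd₀)` and
`fPartProd₀·fPartProd₂ = −x₀₂²·fPartProd₁` (LH4-p09's `glueSign 1 = ω(−1)ω(f₀)ω(1+f₀)`, LH4-p06's `χ₁(f₀) = ω(−f₀(1+f₀))`).
[cite: Rogawski1990, §4.9 p. 55, §4.10 p. 58] [cite: Serre1979, Ch. V §3 Prop. 5, Cor. 3] -/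
theorem normSign_glueWitness_mul_one_add_eq [CompleteSpace K] [Fintype 𝓀[K]] {σ : K →+* K} {ϖ : K} {d t : ℕ} (hD : IsRamifiedQuadraticDatum σ ϖ d t)
    {δ a b : K} (hδ : σ δ = -δ) (hδ0 : δ ≠ 0) (ha : a * σ a = 1) (hb : b * σ b = 1) (hα1 : a * a ≠ 1) (hβ1 : b * b ≠ 1) (hαβ : a * a ≠ b * b)
    {f₀ : K} (hσf₀ : σ f₀ = f₀) (hf0 : f₀ ≠ 0) (hf1 : 1 + f₀ ≠ 0) {n : ℕ} (hn : 2 * d - 1 ≤ n)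
    (hab : Valued.v (a - b) ≤ Valued.v ϖ ^ n) (hb1 : Valued.v (b - 1) ≤ Valued.v ϖ ^ n)
    (hf₀ : Valued.v (f₀ + (b * b - 1) / (a * a - 1)) ≤ Valued.v ϖ ^ n * Valued.v ((b * b - 1) / (a * a - 1)))
    (hf₀' : Valued.v (f₀ + (b * b - 1) / (a * a - 1)) ≤ Valued.v ϖ ^ n * Valued.v (1 - (b * b - 1) / (a * a - 1))) :
    normSign σ (f₀ * (1 + f₀)) = normSign σ (fPartProd δ ![a, b, 1] 1) := by
  have hσf1 : σ (1 + f₀) = 1 + f₀ := by rw [map_add, map_one, hσf₀]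
  rw [normSign_mul_of_fixed hD hσf₀ hσf1 hf0 hf1, normSign_glueWitness_eq hD hδ hδ0 ha hb hα1 hβ1 hσf₀ hn hab hf₀,
    normSign_one_add_glueWitness_eq hD hδ hδ0 ha hb hα1 hαβ hσf₀ hn hb1 hf₀', mul_assoc, normSign_fPartProd_two_mul_zero hD hδ hδ0 ha hb hα1 hβ1 hαβ,
    ← mul_assoc, normSign_mul_self, one_mul]

/-- **THE DICTIONARY IN LH4-p06 (g3)'s H-CURRENCY: `χ_i(f₀, 1, −(1+f₀)⁻¹) = ω(−1)·ω(fPartProd δ (a,b,1) i)` for every slot `i`** — the core-hanging glue token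
`chiVec σ i ![f₀, 1, −(1 + f₀)⁻¹]` (LETTER κB-H §4) IS the law's slot sign `w_i·baseSign_i·ω(fPartProd_i)`, under the hypotheses of (D0) and (D2).
[cite: Rogawski1990, §4.9 p. 55, §4.10 p. 58] [cite: Serre1979, Ch. V §3 Prop. 5, Cor. 3] [cite: LanglandsShelstad1987, §3] -/
theorem chiVec_glueWitness_eq [CompleteSpace K] [Fintype 𝓀[K]] {σ : K →+* K} {ϖ : K} {d t : ℕ} (hD : IsRamifiedQuadraticDatum σ ϖ d t)
    {δ a b : K} (hδ : σ δ = -δ) (hδ0 : δ ≠ 0) (ha : a * σ a = 1) (hb : b * σ b = 1) (hα1 : a * a ≠ 1) (hβ1 : b * b ≠ 1) (hαβ : a * a ≠ b * b)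
    {f₀ : K} (hσf₀ : σ f₀ = f₀) (hf1 : 1 + f₀ ≠ 0) {n : ℕ} (hn : 2 * d - 1 ≤ n)
    (hab : Valued.v (a - b) ≤ Valued.v ϖ ^ n) (hb1 : Valued.v (b - 1) ≤ Valued.v ϖ ^ n)
    (hf₀ : Valued.v (f₀ + (b * b - 1) / (a * a - 1)) ≤ Valued.v ϖ ^ n * Valued.v ((b * b - 1) / (a * a - 1)))
    (hf₀' : Valued.v (f₀ + (b * b - 1) / (a * a - 1)) ≤ Valued.v ϖ ^ n * Valued.v (1 - (b * b - 1) / (a * a - 1))) (i : Fin 3) :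
    chiVec σ i ![f₀, 1, -(1 + f₀)⁻¹] = normSign σ (-1) * normSign σ (fPartProd δ ![a, b, 1] i) := by
  have hσf1 : σ (1 + f₀) = 1 + f₀ := by rw [map_add, map_one, hσf₀]
  -- `ω(−(1+f₀)⁻¹) = ω(−1)·ω(1+f₀)`
  have hinv : normSign σ (-(1 + f₀)⁻¹) = normSign σ (-1) * normSign σ (1 + f₀) := by
    rw [neg_eq_neg_one_mul, normSign_mul_of_fixed hD (by rw [map_neg, map_one]) (by rw [map_inv₀, hσf1]) (neg_ne_zero.2 one_ne_zero) (inv_ne_zero hf1),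
      show (1 + f₀)⁻¹ = (1 + f₀) * ((1 + f₀)⁻¹ * σ (1 + f₀)⁻¹) from by rw [map_inv₀, hσf1]; field_simp, normSign_mul_norm σ _ (inv_ne_zero hf1)]
  have hD2 := normSign_glueWitness_eq hD hδ hδ0 ha hb hα1 hβ1 hσf₀ hn hab hf₀
  have hD0 := normSign_one_add_glueWitness_eq hD hδ hδ0 ha hb hα1 hαβ hσf₀ hn hb1 hf₀'
  have hprod := normSign_fPartProd_two_mul_zero hD hδ hδ0 ha hb hα1 hβ1 hαβ
  have hm1 : normSign σ (-1 : K) * normSign σ (-1) = 1 := normSign_mul_self σ (-1)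
  fin_cases i
  · show normSign σ (1 : K) * normSign σ (-(1 + f₀)⁻¹) = normSign σ (-1) * normSign σ (fPartProd δ ![a, b, 1] 0)
    rw [normSign_one, one_mul, hinv, hD0]
  · show normSign σ f₀ * normSign σ (-(1 + f₀)⁻¹) = normSign σ (-1) * normSign σ (fPartProd δ ![a, b, 1] 1)
    rw [hinv, hD2, hD0, ← hprod]
    linear_combination (normSign σ (fPartProd δ ![a, b, 1] 2) * normSign σ (fPartProd δ ![a, b, 1] 0)) * hm1
  · show normSign σ f₀ * normSign σ (1 : K) = normSign σ (-1) * normSign σ (fPartProd δ ![a, b, 1] 2)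
    rw [normSign_one, mul_one, hD2]

end Valued

end Summit.HodgeConjecture.HodgeConjecture.Cruxes.H413.F0P3cDyRamDiagonalKappaSignDictionary

end
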